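import Literature.MathematicalPhysics.QuantumLattice.GaugeGroups
import HarnessLib

/-!
# `SU(3)` trace identities (reduction formulae) for the lattice loop equations (cell `gauge-boot`, L1, algebraic addendum)

Honest framing (cell rule): certified bounds on lattice expectations at stated coupling, gauge group, dimension and
torus size; NOT a mass gap, NOT a continuum limit, NOT a string tension; not summit-bearing
(`FixedCouplingUltralocality`, `PerturbativeInvisibility`).

The `SU(3)` loop equations of `LoopEquation.lean` (`loopEquation_specialUnitaryGroup 3`) contain double traces and,
through repeated windings, traces of cubes.  The finite-`N = 3` TRACE IDENTITIES that the generators use to close the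
system (Guo–Li–Yang–Zhu, arXiv:2502.14421, App. A "reduction formulae"; Kazakov–Zheng, arXiv:2404.16925 §2.3) are
Cayley–Hamilton for `3 × 3` matrices of determinant one.  This file proves them as plain matrix algebra over any
commutative ring (`[folklore]`):
* `symm₂ M` — the second elementary symmetric function (sum of the principal `2 × 2` minors);
  `trace_adjugate_fin_three : tr (adj M) = symm₂ M`, `two_mul_symm₂ : 2·symm₂ M = (tr M)² − tr(M²)`;
* `trace_inv_fin_three_of_det_eq_one : det M = 1 → tr M⁻¹ = symm₂ M` — for `U ∈ SU(3)`: `tr U† = ½((tr U)² − tr U²)`;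
* `pow_three_eq_fin_three` — CAYLEY–HAMILTON `M³ = (tr M)·M² − symm₂(M)·M + (det M)·1`, whence for `det M = 1` the
  REDUCTION of a triple winding `tr(M³ W) = tr M·tr(M² W) − symm₂ M·tr(M W) + tr W` (`trace_pow_three_mul_of_det_eq_one`);
* the `SU(3)` corollaries `su_three_star_trace` (`conj tr U = ½((tr U)² − tr U²)` as `2·conj tr U = …`) and
  `su_three_reduction`.
-/

namespace Summit.QuantumFields.GaugeBoot

open scoped Matrix

section CommRing

variable {R : Type*} [CommRing R]

/-- The second elementary symmetric function of a `3 × 3` matrix: the sum of its principal `2 × 2` minors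
(`e₂` of the eigenvalues; the `X`-coefficient of the characteristic polynomial). [folklore] -/
def symm₂ (M : Matrix (Fin 3) (Fin 3) R) : R :=
  M 0 0 * M 1 1 - M 0 1 * M 1 0 + (M 0 0 * M 2 2 - M 0 2 * M 2 0) + (M 1 1 * M 2 2 - M 1 2 * M 2 1)

/-- `tr (adj M) = symm₂ M` for a `3 × 3` matrix. [folklore] -/
theorem trace_adjugate_fin_three (M : Matrix (Fin 3) (Fin 3) R) : (Matrix.adjugate M).trace = symm₂ M := by
  rw [Matrix.adjugate_fin_three]
  simp [Matrix.trace, Fin.sum_univ_three, symm₂]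
  ring

/-- Newton's identity `2·symm₂ M = (tr M)² − tr(M²)`. [folklore] -/
theorem two_mul_symm₂ (M : Matrix (Fin 3) (Fin 3) R) : 2 * symm₂ M = M.trace ^ 2 - (M * M).trace := by
  simp only [Matrix.trace, Fin.sum_univ_three, Matrix.diag_apply, Matrix.mul_apply, symm₂]
  ring

/-- **`tr M⁻¹ = symm₂ M` when `det M = 1`** (`M⁻¹ = adj M`). For `U ∈ SU(3)` this is the reduction formula
`tr U† = ½((tr U)² − tr U²)`. [folklore] -/
theorem trace_inv_fin_three_of_det_eq_one (M : Matrix (Fin 3) (Fin 3) R) (h : M.det = 1) :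
    (M⁻¹).trace = symm₂ M := by
  rw [Matrix.inv_def, h, Ring.inverse_one, one_smul, trace_adjugate_fin_three]

/-- **Cayley–Hamilton for `3 × 3` matrices, explicit**: `M³ = (tr M)·M² − symm₂(M)·M + (det M)·1`. [folklore] -/
theorem pow_three_eq_fin_three (M : Matrix (Fin 3) (Fin 3) R) :
    M ^ 3 = M.trace • M ^ 2 - symm₂ M • M + M.det • (1 : Matrix (Fin 3) (Fin 3) R) := by
  ext i j
  fin_cases i <;> fin_cases j <;>
    simp [pow_succ, Matrix.mul_apply, Fin.sum_univ_three, symm₂, Matrix.det_fin_three, Matrix.trace] <;> ring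

/-- **Reduction of a triple winding** (`det M = 1`): `tr(M³ W) = tr M · tr(M² W) − symm₂ M · tr(M W) + tr W` — the
`SU(3)` reduction formula that removes threefold traversals from the loop-equation system. [folklore] -/
theorem trace_pow_three_mul_of_det_eq_one (M W : Matrix (Fin 3) (Fin 3) R) (h : M.det = 1) :
    (M ^ 3 * W).trace = M.trace * (M ^ 2 * W).trace - symm₂ M * (M * W).trace + W.trace := by
  rw [pow_three_eq_fin_three, h, one_smul, Matrix.add_mul, Matrix.sub_mul, Matrix.smul_mul, Matrix.smul_mul,
    Matrix.one_mul, Matrix.trace_add, Matrix.trace_sub, Matrix.trace_smul, Matrix.trace_smul, smul_eq_mul,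
    smul_eq_mul]

end CommRing

section SU3

/-- **`SU(3)`: `2·conj(tr U) = (tr U)² − tr(U²)`** (`U† = U⁻¹ = adj U`). [folklore] -/
theorem su_three_two_mul_star_trace (g : Matrix.specialUnitaryGroup (Fin 3) ℂ) :
    2 * star (g : Matrix (Fin 3) (Fin 3) ℂ).trace =
      (g : Matrix (Fin 3) (Fin 3) ℂ).trace ^ 2 - ((g : Matrix (Fin 3) (Fin 3) ℂ) * g).trace := by
  have hU : (g : Matrix (Fin 3) (Fin 3) ℂ) ∈ Matrix.unitaryGroup (Fin 3) ℂ := g.2.1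
  have hdet : (g : Matrix (Fin 3) (Fin 3) ℂ).det = 1 := g.2.2
  have hinv : (g : Matrix (Fin 3) (Fin 3) ℂ)⁻¹ = star (g : Matrix (Fin 3) (Fin 3) ℂ) :=
    Matrix.inv_eq_left_inv (Matrix.mem_unitaryGroup_iff'.1 hU)
  rw [← two_mul_symm₂, ← trace_inv_fin_three_of_det_eq_one _ hdet, hinv, Matrix.star_eq_conjTranspose,
    Matrix.trace_conjTranspose]

/-- **`SU(3)` Cayley–Hamilton reduction**: `U³ = (tr U)·U² − symm₂(U)·U + 1`, `symm₂ U = conj(tr U)`. [folklore] -/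
theorem su_three_reduction (g : Matrix.specialUnitaryGroup (Fin 3) ℂ) :
    (g : Matrix (Fin 3) (Fin 3) ℂ) ^ 3 =
      (g : Matrix (Fin 3) (Fin 3) ℂ).trace • (g : Matrix (Fin 3) (Fin 3) ℂ) ^ 2 -
        star (g : Matrix (Fin 3) (Fin 3) ℂ).trace • (g : Matrix (Fin 3) (Fin 3) ℂ) + 1 := by
  have hU : (g : Matrix (Fin 3) (Fin 3) ℂ) ∈ Matrix.unitaryGroup (Fin 3) ℂ := g.2.1
  have hdet : (g : Matrix (Fin 3) (Fin 3) ℂ).det = 1 := g.2.2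
  have hinv : (g : Matrix (Fin 3) (Fin 3) ℂ)⁻¹ = star (g : Matrix (Fin 3) (Fin 3) ℂ) :=
    Matrix.inv_eq_left_inv (Matrix.mem_unitaryGroup_iff'.1 hU)
  have hs : star (g : Matrix (Fin 3) (Fin 3) ℂ).trace = symm₂ (g : Matrix (Fin 3) (Fin 3) ℂ) := by
    rw [← trace_inv_fin_three_of_det_eq_one _ hdet, hinv, Matrix.star_eq_conjTranspose, Matrix.trace_conjTranspose]
  rw [hs, pow_three_eq_fin_three, hdet, one_smul]

end SU3

end Summit.QuantumFields.GaugeBoot
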